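import Summits.QuantumFields.YangMills.Theorems.ParabolicTrajectoryLatticeGapOnTrajectorySplitDefs
import HarnessLib

/-!
# Crux `LatticeGapOnTrajectory` (stmt-QuantumFields-10523): vocabulary of the line
# `step-scaling-contraction` (served slug `StepScalingSketch`) — finite-volume OS gap as running coupling

Route-posited objects (D-0016 `<Route><Crux>…Defs` file) for the registered skeleton
`Cruxes/LatticeGapOnTrajectory/Lines/step_scaling_contraction.lean` (card
`Cruxes/LatticeGapOnTrajectory/Ideas/step-scaling-contraction.md`, crux-ideate round 2, ideator 4; skeleton
by lead a3, driven by lead c5). The definitions of §1 are VERBATIM those of the registered skeleton (so the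
registered stub signatures resolve against this file unchanged). Nothing about mass gaps is asserted:
every `def … : Prop` is a statement some registered stub proves or consumes.

* §1 `TorusGapAt`, `fvGap`, `zeta`, `StepLaw`, `UniformStepScaling`, `TunedBoxGap`, `RateFloor` — the
  finite-volume OS gap of Wilson's measure on the symmetric torus of side `2S+1` (variance-normalised
  reflected autocorrelation decay of slab observables, with ADDITIVE thermal slack
  `κ B² e^{−m(2S+1−n−2w)}`), its dimensionless form `ζ = (2S+1)·fvGap` (Lüscher–Weisz–Wolff's
  `z = m(ℓ)ℓ`), a volume-doubling law, the anchor, and the rate floor (the engine's output).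
* §2 glue: `TorusGapAt` is upward closed in the thermal constant; `fvGap`, `zeta`, `TunedBoxGap` are
  monotone in it (used by the composition to read the law and the anchor in one currency).
* §3 THE ANCHOR IS FREE IN THIS CURRENCY (lead c5): for a continuous representation, every `β`, every
  `S` and `0 < μ`, `TorusGapAt ρ β S (μ/(2S+1)) κ` holds as soon as `4·e^μ ≤ κ`, from `‖osCorr‖ ≤ 2B²` alone
  — at rate `μ/(2S+1)` the thermal slack is at least `κB²e^{−μ} ≥ 4B²`, which dominates the trivial bound
  whatever the sign of `osVar`. Hence `μ ≤ zeta ρ β S κ` for `μ ≤ 1`, and the registered anchor stub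
  `stub_tunedBoxGap` holds for EVERY scheme with `(κ, μ) = (4e, 1)`: θ, `β_k → ∞` and simplicity of `G` are
  NOT consumed by the anchor (contrary to the card's reading "θ enters exactly once, as the initial
  condition"); all physics of the line sits in the law `UniformStepScaling`, whose small-`ζ` regime
  (`ζ ≲ log κ`) is governed by the same thermal floor. Recorded here, next to the definition it concerns,
  as `torusGapAt_of_exp_le`, `le_zeta_of_exp_le`, `tunedBoxGap_of_exp_le`, `stub_tunedBoxGap`.

References: Osterwalder–Seiler, Ann. Phys. 110 (1978) 440, §2; Glimm–Jaffe, Quantum Physics (1987),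
§6.1 and §19.7; Lüscher, Commun. Math. Phys. 104 (1986) 177, §1–2; Lüscher–Weisz–Wolff, Nucl. Phys. B 359
(1991) 221, §2; Lüscher, Nucl. Phys. B 219 (1983) 233, §4.
-/

open scoped ComplexConjugate Topology
open Filter MeasureTheory
open Literature.MathematicalPhysics.QuantumLattice Literature.MathematicalPhysics.QuantumFieldTheory
open Summit.QuantumFields.YangMills.Theses.ParabolicTrajectory
open Summit.QuantumFields.YangMills.Cruxes.LatticeGapOnTrajectory.OrbitKantorovichFiniteSize

noncomputable section

namespace Summit.QuantumFields.YangMills.Cruxes.LatticeGapOnTrajectory.StepScaling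

/-! ## §1 Vocabulary (verbatim the registered skeleton's §0) -/

section Defs

variable {G : Type} [Group G] [TopologicalSpace G] [IsTopologicalGroup G] [CompactSpace G]
  [MeasurableSpace G] [BorelSpace G]

/-- **Finite-volume OS gap at rate `m` with thermal constant `κ`** on the symmetric torus of side `2S+1`
at inverse coupling `β` in the representation `ρ`: for every measurable `X` with sup bound `B` depending only
on the links based at lattice times `1, …, w` with `w < S`, and every separation `n` with `n + 2w ≤ 2S+1`,
`‖osCorr μ Θ₀ τ_n X X‖ ≤ osVar μ Θ₀ X · e^{−m n} + κ B² e^{−m (2S+1−n−2w)}`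
(`μ = wilsonMeasure ρ β` on the torus of side `2S+1`, `Θ₀ = GaugeConfig.negReflect` the site time reflection,
`τ_n = torusTimeShift _ n`). Transfer-matrix reading: the vacuum-subtracted OS autocorrelation of `Ψ_X` decays
at rate `m` up to the backward (thermal) propagation over `2S+1−n−2w` lattice units, weighted by the sup norm.
Upward closed in `κ` (`torusGapAt_mono_kappa`); downward closed in `m` whenever `osVar ≥ 0` (reflection
positivity, `β ≥ 0`, `w < S`); FREE at rates `m ≤ log(κ/4)/(2S+1)` (`torusGapAt_of_exp_le`).
(Osterwalder–Seiler 1978 §2; Glimm–Jaffe 1987 §6.1, §19.7.) -/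
def TorusGapAt {N : ℕ} (ρ : G →* Matrix (Fin N) (Fin N) ℂ) (β : ℝ) (S : ℕ) (m κ : ℝ) : Prop :=
  ∀ (w n : ℕ) (X : GaugeConfig 4 (2 * S + 1) G → ℂ) (B : ℝ), Measurable X → (∀ U, ‖X U‖ ≤ B) →
    DependsOn X {e : Edge 4 (2 * S + 1) | 1 ≤ (e.1 0).val ∧ (e.1 0).val ≤ w} →
    w < S → n + 2 * w ≤ 2 * S + 1 →
      ‖osCorr (wilsonMeasure ρ β) GaugeConfig.negReflect (torusTimeShift (2 * S + 1) n) X X‖ ≤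
        osVar (wilsonMeasure ρ β) GaugeConfig.negReflect X * Real.exp (-(m * n)) +
          κ * B ^ 2 * Real.exp (-(m * ((2 * S + 1 : ℝ) - n - 2 * w)))

/-- **The finite-volume gap** of the torus of side `2S+1` at coupling `β`, thermal constant `κ`: the supremum
of the rates `m ∈ [0, 1]` at which `TorusGapAt ρ β S m κ` holds (capped at `1`; `Real.sSup ∅ = 0`; the set is
non-empty as soon as `κ ≥ 4`, `torusGapAt_of_exp_le`). (Lüscher 1986 §2.) -/
def fvGap {N : ℕ} (ρ : G →* Matrix (Fin N) (Fin N) ℂ) (β : ℝ) (S : ℕ) (κ : ℝ) : ℝ :=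
  sSup {m : ℝ | 0 ≤ m ∧ m ≤ 1 ∧ TorusGapAt ρ β S m κ}

/-- **The step-scaling variable** `ζ = (2S+1) · m(S)`: the finite-volume gap in units of the inverse box side
(Lüscher–Weisz–Wolff's `z = m(ℓ) ℓ`, with the gap itself as the running coupling). (Lüscher–Weisz–Wolff 1991 §2.) -/
def zeta {N : ℕ} (ρ : G →* Matrix (Fin N) (Fin N) ℂ) (β : ℝ) (S : ℕ) (κ : ℝ) : ℝ :=
  (2 * S + 1 : ℝ) * fvGap ρ β S κ

/-- **A volume-doubling law**: a continuous minorant `Φ` of the doubling map `ζ(S) ↦ ζ(2S)` with NO fixed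
point on `(0, ∞)` (`ζ < Φ ζ`), the finite-size mass-shift shape `Φ ζ ≥ 2ζ − C` for `ζ ≥ ζ₁`, an
intermediate-volume factor `λ ∈ (0, 1]` (`ζ(S′) ≥ λ ζ(S)` for `S ≤ S′ ≤ 2S`) and the thermal constant `κ`
of the currency in which `ζ` is read. (Lüscher–Weisz–Wolff 1991 §2; Lüscher 1986 §1.) -/
structure StepLaw where
  /-- the doubling minorant -/
  Φ : ℝ → ℝ
  /-- intermediate-volume factor -/
  lam : ℝ
  /-- thermal constant of the currency -/
  κ : ℝ
  /-- mass-shift constant -/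
  C : ℝ
  /-- threshold of the mass-shift regime -/
  ζ₁ : ℝ
  continuous : Continuous Φ
  lt_map : ∀ ζ : ℝ, 0 < ζ → ζ < Φ ζ
  two_mul_sub_le : ∀ ζ : ℝ, ζ₁ ≤ ζ → 2 * ζ - C ≤ Φ ζ
  lam_pos : 0 < lam
  lam_le_one : lam ≤ 1

/-- **Uniform step scaling along a scheme** (the physics of the line) with anchor sides `D k`: eventually in
`k`, for every `S ≥ D k`, the step-scaling variable of Wilson's torus at `β_k` obeys the doubling law,
`Φ(ζ_k(S)) ≤ ζ_k(2S)`, and the intermediate-volume bound `λ ζ_k(S) ≤ ζ_k(S')` for `S ≤ S' ≤ 2S`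
(`ζ_k(S) = zeta r.ρ (sch.β k) S law.κ`). For `U(1)` the doubling map HAS a fixed point (free photons):
the statement is false there, as it must be. (Lüscher–Weisz–Wolff 1991 §2.) -/
def UniformStepScaling (r : LatticeRep G) (sch : SpeciesScheme (YMSpecies G)) (D : ℕ → ℕ)
    (law : StepLaw) : Prop :=
  ∀ᶠ k in atTop, ∀ S : ℕ, D k ≤ S →
    law.Φ (zeta r.ρ (sch.β k) S law.κ) ≤ zeta r.ρ (sch.β k) (2 * S) law.κ ∧
      ∀ S' : ℕ, S ≤ S' → S' ≤ 2 * S → law.lam * zeta r.ρ (sch.β k) S law.κ ≤ zeta r.ρ (sch.β k) S' law.κ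

/-- **The anchor**: eventually in `k` the step-scaling variable of the anchor box `S = D k` is at least
`μ` (for the crux `D k = M^{n_k}`, the box of physical side `≈ 2`). WARNING (lead c5, §3 below): in this
currency the anchor is FREE — `TunedBoxGap r sch D κ μ` holds for every scheme as soon as `4e^μ ≤ κ` and
`0 < μ ≤ 1` (`tunedBoxGap_of_exp_le`); it carries information only for `μ > log(κ/4)`. (Lüscher 1983 §4.) -/
def TunedBoxGap (r : LatticeRep G) (sch : SpeciesScheme (YMSpecies G)) (D : ℕ → ℕ) (κ μ : ℝ) : Prop :=
  ∀ᶠ k in atTop, μ ≤ zeta r.ρ (sch.β k) (D k) κ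

/-- **Rate floor** (the engine's output): eventually in `k`, on EVERY torus `S ≥ D k` the finite-volume OS gap
statement holds at the lattice rate `Δ · a_k` (physical rate `Δ`) with thermal constant `κ`.
(Glimm–Jaffe 1987 §19.7.) -/
def RateFloor (r : LatticeRep G) (sch : SpeciesScheme (YMSpecies G)) (D : ℕ → ℕ) (κ Δ : ℝ) : Prop :=
  ∀ᶠ k in atTop, ∀ S : ℕ, D k ≤ S → TorusGapAt r.ρ (sch.β k) S (Δ * sch.a k) κ

end Defs

/-! ## §2 Glue: monotonicity in the thermal constant -/

section Glue

variable {G : Type} [Group G] [TopologicalSpace G] [IsTopologicalGroup G] [CompactSpace G]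
  [MeasurableSpace G] [BorelSpace G] {N : ℕ}

/-- `TorusGapAt` is upward closed in the thermal constant. -/
theorem torusGapAt_mono_kappa (ρ : G →* Matrix (Fin N) (Fin N) ℂ) (β : ℝ) (S : ℕ) {m κ κ' : ℝ}
    (hκ : κ ≤ κ') (h : TorusGapAt ρ β S m κ) : TorusGapAt ρ β S m κ' := by
  intro w n X B hX hB hdep hw hn
  refine (h w n X B hX hB hdep hw hn).trans ?_
  have : κ * B ^ 2 * Real.exp (-(m * ((2 * S + 1 : ℝ) - n - 2 * w))) ≤
      κ' * B ^ 2 * Real.exp (-(m * ((2 * S + 1 : ℝ) - n - 2 * w))) :=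
    mul_le_mul_of_nonneg_right (mul_le_mul_of_nonneg_right hκ (sq_nonneg B)) (Real.exp_pos _).le
  linarith

/-- `fvGap` is monotone in the thermal constant. -/
theorem fvGap_mono_kappa (ρ : G →* Matrix (Fin N) (Fin N) ℂ) (β : ℝ) (S : ℕ) {κ κ' : ℝ}
    (hκ : κ ≤ κ') : fvGap ρ β S κ ≤ fvGap ρ β S κ' := by
  unfold fvGap
  set A : Set ℝ := {m : ℝ | 0 ≤ m ∧ m ≤ 1 ∧ TorusGapAt ρ β S m κ} with hA
  set A' : Set ℝ := {m : ℝ | 0 ≤ m ∧ m ≤ 1 ∧ TorusGapAt ρ β S m κ'} with hA'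
  have hsub : A ⊆ A' := fun m hm => ⟨hm.1, hm.2.1, torusGapAt_mono_kappa ρ β S hκ hm.2.2⟩
  have hbdd : BddAbove A' := ⟨1, fun m hm => hm.2.1⟩
  rcases A.eq_empty_or_nonempty with hAe | hAn
  · rw [hAe, Real.sSup_empty]
    rcases A'.eq_empty_or_nonempty with hA'e | hA'n
    · rw [hA'e, Real.sSup_empty]
    · obtain ⟨m, hm⟩ := hA'n
      exact le_csSup_of_le hbdd hm hm.1
  · exact csSup_le_csSup hbdd hAn hsub

/-- `zeta` is monotone in the thermal constant. -/
theorem zeta_mono_kappa (ρ : G →* Matrix (Fin N) (Fin N) ℂ) (β : ℝ) (S : ℕ) {κ κ' : ℝ}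
    (hκ : κ ≤ κ') : zeta ρ β S κ ≤ zeta ρ β S κ' :=
  mul_le_mul_of_nonneg_left (fvGap_mono_kappa ρ β S hκ) (by positivity)

/-- The anchor is monotone in the thermal constant. -/
theorem tunedBoxGap_mono_kappa (r : LatticeRep G) (sch : SpeciesScheme (YMSpecies G)) (D : ℕ → ℕ)
    {κ κ' μ : ℝ} (hκ : κ ≤ κ') (h : TunedBoxGap r sch D κ μ) : TunedBoxGap r sch D κ' μ :=
  h.mono fun k hk => hk.trans (zeta_mono_kappa r.ρ (sch.β k) (D k) hκ)

/-- `RateFloor` is upward closed in the thermal constant. -/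
theorem rateFloor_mono_kappa (r : LatticeRep G) (sch : SpeciesScheme (YMSpecies G)) (D : ℕ → ℕ)
    {κ κ' Δ : ℝ} (hκ : κ ≤ κ') (h : RateFloor r sch D κ Δ) : RateFloor r sch D κ' Δ :=
  h.mono fun k hk S hS => torusGapAt_mono_kappa r.ρ (sch.β k) S hκ (hk S hS)

end Glue

/-! ## §3 The anchor is free in this currency (lead c5) -/

section Free

variable {G : Type} [Group G] [TopologicalSpace G] [IsTopologicalGroup G] [CompactSpace G]
  [MeasurableSpace G] [BorelSpace G] {N : ℕ}

/-- Norm bound for the reflected, translated connected correlation of ONE bounded observable under a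
probability measure: `‖osCorr μ Θ τ X X‖ ≤ 2 B²` (both terms are integrals of products of two functions
bounded by `B`). -/
theorem norm_osCorr_self_le {Ω : Type*} [MeasurableSpace Ω] (μ : Measure Ω) [IsProbabilityMeasure μ]
    (Θ τ : Ω → Ω) {X : Ω → ℂ} {B : ℝ} (hB : ∀ ω, ‖X ω‖ ≤ B) :
    ‖osCorr μ Θ τ X X‖ ≤ 2 * B ^ 2 := by
  have hpt : ∀ ω, ‖conj (X (Θ ω)) * X (τ ω)‖ ≤ B * B := fun ω => by
    rw [norm_mul, RCLike.norm_conj]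
    exact mul_le_mul (hB _) (hB _) (norm_nonneg _) ((norm_nonneg _).trans (hB (τ ω)))
  have h1 : ‖∫ ω, conj (X (Θ ω)) * X (τ ω) ∂μ‖ ≤ B ^ 2 := by
    have h := norm_integral_le_of_norm_le_const (μ := μ) (Eventually.of_forall hpt)
    simpa [sq] using h
  have h2 : ‖∫ ω, X ω ∂μ‖ ≤ B := by
    have h := norm_integral_le_of_norm_le_const (μ := μ) (Eventually.of_forall hB)
    simpa using h
  have h3 : ‖conj (∫ ω, X ω ∂μ) * ∫ ω, X ω ∂μ‖ ≤ B ^ 2 := by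
    rw [norm_mul, RCLike.norm_conj, sq]
    exact mul_le_mul h2 h2 (norm_nonneg _) ((norm_nonneg _).trans h2)
  unfold osCorr
  exact (norm_sub_le _ _).trans (by linarith)

/-- **The thermal floor.** For a continuous representation, every coupling `β`, every half-side `S` and every
`μ > 0`: `TorusGapAt ρ β S (μ/(2S+1)) κ` holds as soon as `4·e^μ ≤ κ`. At rate `μ/(2S+1)` the thermal slack is
`≥ κ B² e^{−μ} ≥ 4B²`, the `osVar` term is `≥ −2B²`, and `‖osCorr‖ ≤ 2B²` — no property of Wilson's measure beyond
total mass one is used. -/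
theorem torusGapAt_of_exp_le {ρ : G →* Matrix (Fin N) (Fin N) ℂ} (hρ : Continuous ρ) (β : ℝ) (S : ℕ)
    {μ κ : ℝ} (hμ : 0 < μ) (hκ : 4 * Real.exp μ ≤ κ) :
    TorusGapAt ρ β S (μ / (2 * S + 1)) κ := by
  intro w n X B _hX hB _hdep _hw hn
  haveI := isProbabilityMeasure_wilsonMeasure (d := 4) (L := 2 * S + 1) (G := G) ρ hρ β
  set ν := wilsonMeasure (d := 4) (L := 2 * S + 1) (G := G) ρ β with hν
  set m : ℝ := μ / (2 * S + 1) with hm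
  have hT : (0 : ℝ) < 2 * S + 1 := by positivity
  have hm0 : 0 ≤ m := div_nonneg hμ.le hT.le
  have hB2 : ‖osCorr ν GaugeConfig.negReflect (torusTimeShift (2 * S + 1) n) X X‖ ≤ 2 * B ^ 2 :=
    norm_osCorr_self_le ν _ _ hB
  -- the `osVar` term is at least `-2 B²`
  have hV : -(2 * B ^ 2) ≤ osVar ν GaugeConfig.negReflect X * Real.exp (-(m * n)) := by
    have hVabs : |osVar ν GaugeConfig.negReflect X| ≤ 2 * B ^ 2 := by
      unfold osVar
      exact (Complex.abs_re_le_norm _).trans (norm_osCorr_self_le ν _ _ hB)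
    have hVlow : -(2 * B ^ 2) ≤ osVar ν GaugeConfig.negReflect X := (abs_le.1 hVabs).1
    have he1 : Real.exp (-(m * n)) ≤ 1 := by
      rw [Real.exp_le_one_iff]; nlinarith [Nat.cast_nonneg (α := ℝ) n]
    have he0 : 0 < Real.exp (-(m * n)) := Real.exp_pos _
    rcases le_or_gt 0 (osVar ν GaugeConfig.negReflect X) with hpos | hneg
    · nlinarith [mul_nonneg hpos he0.le, sq_nonneg B]
    · nlinarith
  -- the thermal slack is at least `κ B² e^{-μ} ≥ 4 B²`
  have hexp : Real.exp (-μ) ≤ Real.exp (-(m * ((2 * S + 1 : ℝ) - n - 2 * w))) := by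
    rw [Real.exp_le_exp]
    have h1 : m * ((2 * S + 1 : ℝ) - n - 2 * w) ≤ m * (2 * S + 1 : ℝ) :=
      mul_le_mul_of_nonneg_left (by nlinarith [Nat.cast_nonneg (α := ℝ) n, Nat.cast_nonneg (α := ℝ) w]) hm0
    have h2 : m * (2 * S + 1 : ℝ) = μ := by rw [hm]; field_simp
    linarith
  have hκ0 : 0 ≤ κ := le_trans (by positivity) hκ
  have hth : 4 * B ^ 2 ≤ κ * B ^ 2 * Real.exp (-(m * ((2 * S + 1 : ℝ) - n - 2 * w))) := by
    have h4 : 4 ≤ κ * Real.exp (-μ) := by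
      have := mul_le_mul_of_nonneg_right hκ (Real.exp_pos (-μ)).le
      rwa [mul_assoc, ← Real.exp_add, add_neg_cancel, Real.exp_zero, mul_one] at this
    calc 4 * B ^ 2 ≤ κ * Real.exp (-μ) * B ^ 2 := mul_le_mul_of_nonneg_right h4 (sq_nonneg B)
      _ = κ * B ^ 2 * Real.exp (-μ) := by ring
      _ ≤ κ * B ^ 2 * Real.exp (-(m * ((2 * S + 1 : ℝ) - n - 2 * w))) :=
          mul_le_mul_of_nonneg_left hexp (mul_nonneg hκ0 (sq_nonneg B))
  linarith

/-- **The step-scaling variable has a free floor**: `μ ≤ zeta ρ β S κ` whenever `0 < μ ≤ 1` and `4e^μ ≤ κ`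
(the rate `μ/(2S+1) ≤ 1` belongs to the set whose supremum is `fvGap`). -/
theorem le_zeta_of_exp_le {ρ : G →* Matrix (Fin N) (Fin N) ℂ} (hρ : Continuous ρ) (β : ℝ) (S : ℕ)
    {μ κ : ℝ} (hμ : 0 < μ) (hμ1 : μ ≤ 1) (hκ : 4 * Real.exp μ ≤ κ) : μ ≤ zeta ρ β S κ := by
  have hT : (0 : ℝ) < 2 * S + 1 := by positivity
  have hT1 : (1 : ℝ) ≤ 2 * S + 1 := by
    have : (0 : ℝ) ≤ S := Nat.cast_nonneg S
    linarith
  have hmem : μ / (2 * S + 1) ∈ {m : ℝ | 0 ≤ m ∧ m ≤ 1 ∧ TorusGapAt ρ β S m κ} := by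
    refine ⟨div_nonneg hμ.le hT.le, ?_, torusGapAt_of_exp_le hρ β S hμ hκ⟩
    rw [div_le_one hT]
    exact hμ1.trans hT1
  have hbdd : BddAbove {m : ℝ | 0 ≤ m ∧ m ≤ 1 ∧ TorusGapAt ρ β S m κ} := ⟨1, fun m hm => hm.2.1⟩
  have hle : μ / (2 * S + 1) ≤ fvGap ρ β S κ := le_csSup hbdd hmem
  unfold zeta
  calc μ = (2 * S + 1 : ℝ) * (μ / (2 * S + 1)) := by field_simp
    _ ≤ (2 * S + 1 : ℝ) * fvGap ρ β S κ := mul_le_mul_of_nonneg_left hle hT.le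

/-- **The anchor is free**: `TunedBoxGap r sch D κ μ` for EVERY representation, scheme and anchor sides, as
soon as `0 < μ ≤ 1` and `4e^μ ≤ κ`. -/
theorem tunedBoxGap_of_exp_le (r : LatticeRep G) (sch : SpeciesScheme (YMSpecies G)) (D : ℕ → ℕ)
    {κ μ : ℝ} (hμ : 0 < μ) (hμ1 : μ ≤ 1) (hκ : 4 * Real.exp μ ≤ κ) : TunedBoxGap r sch D κ μ :=
  Eventually.of_forall fun k => le_zeta_of_exp_le r.continuous (sch.β k) (D k) hμ hμ1 hκ

/-- **stub_tunedBoxGap** (registered stub of the skeleton `Lines/step_scaling_contraction.lean`, signature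
verbatim) — DISCHARGED WITHOUT PHYSICS: `(κ, μ) = (4e, 1)` works for every scheme by `tunedBoxGap_of_exp_le`.
None of the crux hypotheses (simplicity of `G`, `M`-adic shape, `β_k → ∞`, the tuning `θ`) is used: in the
`TorusGapAt` currency the anchor of the step-scaling ladder carries no information, and the line's physics is
entirely in `UniformStepScaling`. -/
theorem stub_tunedBoxGap :
    ∀ (G : Type) [Group G] [TopologicalSpace G] [IsTopologicalGroup G] [CompactSpace G]
      [MeasurableSpace G] [BorelSpace G], IsCompactSimpleLieGroup G →
      ∀ (r : LatticeRep G) (M : ℕ) (θ : ℝ) (sch : SpeciesScheme (YMSpecies G)) (n : ℕ → ℕ),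
        2 ≤ M → 0 < θ → (∀ k, sch.a k = ((M : ℝ) ^ n k)⁻¹) → Tendsto sch.β atTop atTop →
        Tendsto (fun k => ((M : ℝ) ^ n k) ^ 8 *
            latticeConnectedCorr r.ρ (sch.β k) (sch.side k) r.curvature.F r.curvature.F (M ^ n k))
          atTop (𝓝 θ) →
        ∃ κ μ : ℝ, 2 ≤ κ ∧ 0 < μ ∧ TunedBoxGap r sch (fun k => M ^ n k) κ μ := by
  intro G _ _ _ _ _ _ _ r M _ sch n _ _ _ _ _
  have he : (1 : ℝ) ≤ Real.exp 1 := by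
    have := Real.add_one_le_exp (1 : ℝ)
    linarith
  exact ⟨4 * Real.exp 1, 1, by linarith, one_pos,
    tunedBoxGap_of_exp_le r sch (fun k => M ^ n k) one_pos le_rfl le_rfl⟩

end Free

end Summit.QuantumFields.YangMills.Cruxes.LatticeGapOnTrajectory.StepScaling

end
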